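/-
Copyright (c) 2026 the pub-hodgecm-mathlib formalisation cell (harness21).  Prover seat hodgecm-mathlib-LH4-p07 (g4), req620 Track A «(D-RAM) FOUR-FRAME» squad
(heir LEAD F0P3a-plan lineage; dealer LH4-plan lineage WORD #26 (1); MS ROAD A, Stage B₂ brick B7₂ (iii)₂ «CORE-HANGING STRATA, TYPE 2 — THE CLASS COUNT», FILE (a):
the arithmetic of the `σ`-fixed unit classes; Stage B lead LH4-p10 (g2); re-keyed on multiplicity by LH4-p11 (g2) 2026-09-04T00:53Z).  2026-09-04.
-/
import Summits.HodgeConjecture.HodgeConjecture.Theorems.F0P3cDyRamDiagonalCoreHangingClasses   -- ★ p856022 (this seat's g3, B7 (iv) (B)): the template `ncard_bad_representatives_eq`; brings ★ `…GluedClassRepresentatives` (`exists_fixed_class_representatives`), ★ B1 `relIndex_fixedUnitLevel_eq`, ★ `v_pow_eq_exp_neg`, `Mathlib.GroupTheory.QuotientGroup.Basic`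
import Literature.NumberTheory.Automorphic.UnitaryLatticeTreeTubeCoordinate                    -- ★ `v_pow_eq_exp_neg` (`|ϖ|^n = exp(−n)`)
import HarnessLib

/-!
# Crux `H413`, MS ROAD A, STAGE B₂ brick B7₂ (iii)₂, FILE (a): «HOW MANY CLASSES MODULO `𝔭^{n+1}` OF `σ`-FIXED UNITS LIE IN ONE CLASS MODULO `𝔭^n`» — `q^{⌈(n+1)∕2⌉ − ⌈n∕2⌉}`
# (`= q` for even `n`, `1` for odd `n`)

Cell `hodgecm-mathlib` (D-0151), FLOOR 0, crux item H413 = `stmt-HodgeConjecture-24833`; lane `--supports stmt-HodgeConjecture-24833 --as helper` (count-neutral).  THEOREMS ONLY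
(no `def`, no instance, no notation, no `sorry`, default heartbeats).  PURE ARITHMETIC OF THE RAMIFIED QUADRATIC DATUM, no lattice.
WHY (LH4-p11 (g2)'s re-key of the type-2 half of (MS) on `polarisationCount`, 2026-09-04T00:53Z; this seat's B7₂ files (A) p856406 ∕ (B) ∕ (ii)₂): on a core-hanging type-2 frame
`V = (1 0 0; x ϖ^ρ 0; xζ+y″ ϖ^ρζ ϖ^{2ρ+1})` two type-2 polarisations are `S_F`-related iff their `σ`-fixed unit letters `f` agree modulo `𝔭^{ρ+1}` ((ii)₂
`…CoreHangingPolarisationClassesTypeTwo.exists_mem_fixedUnitStabilizer_iff_v_sub_le`), while (R) lets `f` range over exactly ONE class modulo `𝔭^ρ`; so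
`n₂(latt V) = polarisationCount σ ϖ 2 (latt V)` is the number computed HERE at `n = ρ`:
  `#{classes mod 𝔭^{n+1} of σ-fixed units inside one class mod 𝔭^n} = [U_F ∩ (1+𝔭^n) : U_F ∩ (1+𝔭^{n+1})] = (q−1)q^{⌈(n+1)∕2⌉−1} ∕ ((q−1)q^{⌈n∕2⌉−1}) = q^{(n+2)∕2 − (n+1)∕2}`
(★ B1 (C4) `relIndex_fixedUnitLevel_eq` twice and the tower `U_{n+1} ≤ U_n ≤ U_F`; in `K`-valuation a `σ`-fixed element of valuation `≤ |ϖ|^n` has EVEN valuation, which is why the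
count jumps only at even `n`).  Stated, as ★ `ncard_bad_representatives_eq` (B7 (iv) (B), the template of the proof), on a complete irredundant system `R` of `σ`-fixed units
modulo `𝔭^{n+1}` (★ `exists_fixed_class_representatives` at level `n+1`): **`#{g ∈ R : |g − f₀| ≤ |ϖ|^n} = q^{(n+2)∕2 − (n+1)∕2}`** for any fixed unit `f₀` — via the bijection
`g ↦ [g∕f₀] ∈ U_n ⧸ U_{n+1}`.  LH4-r01 (g3) DV ∕ REF5 R5-78 (C) ∕ R5-86 ∕ R5-90 ∕ LH4-p10 (g2) 01:03:42Z tables: `n₂ = q` on `H(2ρ+1)` for even `ρ ≥ 2`, `1` for odd `ρ` (q = 4: 4, 1, 4, 1 at ρ = 1…4 ✓).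
* `ceil_succ_exponent_eq` — the exponent bookkeeping `(n+2)∕2 − 1 = ((n+1)∕2 − 1) + ((n+2)∕2 − (n+1)∕2)` (`n ≥ 1`).
* **`ncard_reps_near_eq`** — the head.
HONEST LABEL.  Count-neutral; the census laws stay PROVER TARGETS until the MS assembly lands; `HC_CM` is proved only modulo the 7 printed citations (2 remaining named inputs:
hLiu418 = `stmt-HodgeConjecture-24832`, h413 = `stmt-HodgeConjecture-24833`) until rung 0 closes.

## References
* [Serre1979] J.-P. Serre, *Local Fields*, GTM 67, Springer (1979), Ch. IV §2 Prop. 6 (the filtration `U^{(n)}` and its successive quotients).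
* [Kottwitz1986BaseChangeUnits] R. Kottwitz, *Base change for unit elements of Hecke algebras*, Compositio Math. 60 (1986), §1 pp. 240–241 (counting modulo the torus).
-/

set_option autoImplicit false

noncomputable section

namespace Summit.HodgeConjecture.HodgeConjecture.Cruxes.H413.F0P3cDyRamDiagonalFixedClassRefinementCount

open WithZero
open Literature.NumberTheory.LocalFields.WildQuadraticDatum
open Literature.NumberTheory.Automorphic.UnitaryLatticeTree (v_pow_eq_exp_neg)
open scoped Valued

variable {K : Type*} [Field K] [Valued K ℤᵐ⁰]

/-- Exponent bookkeeping: `(n+2)∕2 − 1 = ((n+1)∕2 − 1) + ((n+2)∕2 − (n+1)∕2)` for `n ≥ 1` (both sides `⌈(n+1)∕2⌉ − 1`). [cite: Serre1979, Ch. IV §2 Prop. 6] -/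
theorem ceil_succ_exponent_eq {n : ℕ} (hn : 1 ≤ n) : (n + 2) / 2 - 1 = ((n + 1) / 2 - 1) + ((n + 2) / 2 - (n + 1) / 2) := by
  omega

/-- **THE NUMBER OF CLASSES MODULO `𝔭^{n+1}` OF `σ`-FIXED UNITS INSIDE ONE CLASS MODULO `𝔭^n` IS `q^{(n+2)∕2 − (n+1)∕2}`** (`= q` for even `n`, `1` for odd `n`).  For the ramified
quadratic datum letters `hσ hvσ hfix hϖ hd`, a finite residue field (`q = #𝓀`), `n ≥ 1`, a system `R` of `σ`-fixed units complete and irredundant modulo `𝔭^{n+1}`, and any `σ`-fixed unit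
`f₀`: `#{g ∈ R : |g − f₀| ≤ |ϖ|^n} = q^{(n+2)∕2 − (n+1)∕2}` (`= [U_{F,n} : U_{F,n+1}]` by ★ B1 twice, via `g ↦ [g∕f₀]`). [cite: Serre1979, Ch. IV §2 Prop. 6] [cite: Kottwitz1986BaseChangeUnits, §1 pp. 240–241] -/
theorem ncard_reps_near_eq {σ : K →+* K} {ϖ : K} {d : ℕ} (hσ : ∀ x, σ (σ x) = x) (hvσ : ∀ a, Valued.v (σ a) = Valued.v a)
    (hfix : ∀ x : K, σ x = x → x ≠ 0 → ∃ n : ℤ, Valued.v x = exp (2 * n)) (hϖ : Valued.v ϖ = exp (-1 : ℤ))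
    (hd : Valued.v (ϖ - σ ϖ) = Valued.v ϖ ^ d) [Finite 𝓀[K]] {n : ℕ} (hn : 1 ≤ n) {R : Set K} (hRfin : R.Finite)
    (hR1 : ∀ g ∈ R, σ g = g ∧ Valued.v g = 1) (hR2 : ∀ f : K, σ f = f → Valued.v f = 1 → ∃ g ∈ R, Valued.v (f - g) ≤ Valued.v ϖ ^ (n + 1))
    (hR3 : ∀ g ∈ R, ∀ g' ∈ R, Valued.v (g - g') ≤ Valued.v ϖ ^ (n + 1) → g = g')
    {f₀ : K} (hσf₀ : σ f₀ = f₀) (hvf₀ : Valued.v f₀ = 1) :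
    {g ∈ R | Valued.v (g - f₀) ≤ Valued.v ϖ ^ n}.ncard = Nat.card 𝓀[K] ^ ((n + 2) / 2 - (n + 1) / 2) := by
  classical
  have hϖn : Valued.v ϖ ^ n = exp (-(n : ℤ)) := v_pow_eq_exp_neg hϖ n
  have hϖn1 : Valued.v ϖ ^ (n + 1) = exp (-((n + 1 : ℕ) : ℤ)) := v_pow_eq_exp_neg hϖ (n + 1)
  have hϖle : Valued.v ϖ ^ (n + 1) ≤ Valued.v ϖ ^ n := by rw [hϖn, hϖn1, exp_le_exp]; push_cast; omega
  have hf₀0 : f₀ ≠ 0 := fun h0 => by rw [h0, map_zero] at hvf₀; exact zero_ne_one hvf₀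
  -- the fixed units `U`, the level-`n` and level-`n+1` subgroups
  let U : Subgroup Kˣ :=
    { carrier := {u | σ (u : K) = u ∧ Valued.v (u : K) = 1}
      mul_mem' := fun {a b} ha hb => ⟨by rw [Units.val_mul, map_mul, ha.1, hb.1], by rw [Units.val_mul, map_mul, ha.2, hb.2, mul_one]⟩
      one_mem' := ⟨by rw [Units.val_one, map_one], by rw [Units.val_one, map_one]⟩
      inv_mem' := fun {a} ha => ⟨by rw [Units.val_inv_eq_inv_val, map_inv₀, ha.1], by rw [Units.val_inv_eq_inv_val, map_inv₀, ha.2, inv_one]⟩ }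
  have hU : ∀ u : Kˣ, u ∈ U ↔ σ u = u ∧ Valued.v (u : K) = 1 := fun u => Iff.rfl
  have mkLevel : ∀ m : ℕ, ∃ Um : Subgroup Kˣ, ∀ u : Kˣ, u ∈ Um ↔ (σ u = u ∧ Valued.v (u : K) = 1) ∧ Valued.v ((u : K) - 1) ≤ exp (-(m : ℤ)) := fun m =>
    ⟨{ carrier := {u | (σ (u : K) = u ∧ Valued.v (u : K) = 1) ∧ Valued.v ((u : K) - 1) ≤ exp (-(m : ℤ))}
       mul_mem' := fun {a b} ha hb => by
         refine ⟨⟨by rw [Units.val_mul, map_mul, ha.1.1, hb.1.1], by rw [Units.val_mul, map_mul, ha.1.2, hb.1.2, mul_one]⟩, ?_⟩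
         have h : (a : K) * b - 1 = a * ((b : K) - 1) + ((a : K) - 1) := by ring
         rw [Units.val_mul, h]
         refine Valuation.map_add_le _ ?_ ha.2
         rw [map_mul, ha.1.2, one_mul]; exact hb.2
       one_mem' := ⟨⟨by rw [Units.val_one, map_one], by rw [Units.val_one, map_one]⟩, by rw [Units.val_one, sub_self, map_zero]; exact zero_le⟩
       inv_mem' := fun {a} ha => by
         refine ⟨⟨by rw [Units.val_inv_eq_inv_val, map_inv₀, ha.1.1], by rw [Units.val_inv_eq_inv_val, map_inv₀, ha.1.2, inv_one]⟩, ?_⟩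
         have h : ((a⁻¹ : Kˣ) : K) - 1 = (a⁻¹ : Kˣ) * (1 - (a : K)) := by
           rw [mul_sub, mul_one, ← Units.val_mul, inv_mul_cancel, Units.val_one]
         rw [h, map_mul, Units.val_inv_eq_inv_val, map_inv₀, ha.1.2, inv_one, one_mul, Valuation.map_sub_swap]
         exact ha.2 }, fun _ => Iff.rfl⟩
  obtain ⟨Un, hUn⟩ := mkLevel n
  obtain ⟨Un1, hUn1⟩ := mkLevel (n + 1)
  have hlen : Un ≤ U := fun u hu => ((hUn u).1 hu).1
  have hle1 : Un1 ≤ Un := fun u hu => by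
    rw [hUn]; rw [hUn1] at hu
    exact ⟨hu.1, hu.2.trans (exp_le_exp.2 (by push_cast; omega))⟩
  -- the indices (★ B1 twice, and the tower)
  have hidxn : Un.relIndex U = (Nat.card 𝓀[K] - 1) * Nat.card 𝓀[K] ^ ((n + 1) / 2 - 1) := relIndex_fixedUnitLevel_eq hσ hvσ hfix hϖ hd hU hn hUn
  have hidxn1 : Un1.relIndex U = (Nat.card 𝓀[K] - 1) * Nat.card 𝓀[K] ^ ((n + 2) / 2 - 1) := by
    rw [relIndex_fixedUnitLevel_eq hσ hvσ hfix hϖ hd hU (by omega : 1 ≤ n + 1) (by exact_mod_cast hUn1)]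
  have hq : 1 < Nat.card 𝓀[K] := Finite.one_lt_card
  have hB : Un1.relIndex Un = Nat.card 𝓀[K] ^ ((n + 2) / 2 - (n + 1) / 2) := by
    have h := Subgroup.relIndex_mul_relIndex Un1 Un U hle1 hlen
    rw [hidxn, hidxn1, ceil_succ_exponent_eq hn, pow_add] at h
    have h' : ((Nat.card 𝓀[K] - 1) * Nat.card 𝓀[K] ^ ((n + 1) / 2 - 1)) * Un1.relIndex Un =
        ((Nat.card 𝓀[K] - 1) * Nat.card 𝓀[K] ^ ((n + 1) / 2 - 1)) * Nat.card 𝓀[K] ^ ((n + 2) / 2 - (n + 1) / 2) := by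
      rw [mul_comm _ (Un1.relIndex Un), h]; ring
    have hq1 : Nat.card 𝓀[K] - 1 ≠ 0 := by omega
    have hq0 : Nat.card 𝓀[K] ≠ 0 := by omega
    exact mul_left_cancel₀ (mul_ne_zero hq1 (pow_ne_zero _ hq0)) h'
  -- the bijection `R₀ → Un ⧸ Un1`, `g ↦ [g∕f₀]`
  set R₀ : Set K := {g ∈ R | Valued.v (g - f₀) ≤ Valued.v ϖ ^ n} with hR₀
  have hR₀Un : ∀ g ∈ R₀, ∃ hg0 : g / f₀ ≠ 0, Units.mk0 (g / f₀) hg0 ∈ Un := by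
    rintro g ⟨hgR, hg⟩
    obtain ⟨hσg, hvg⟩ := hR1 g hgR
    have hg0' : g ≠ 0 := fun h0 => by rw [h0, map_zero] at hvg; exact zero_ne_one hvg
    have hg0 : g / f₀ ≠ 0 := div_ne_zero hg0' hf₀0
    refine ⟨hg0, (hUn _).2 ⟨⟨by rw [Units.val_mk0, map_div₀, hσg, hσf₀], by rw [Units.val_mk0, map_div₀, hvg, hvf₀, div_one]⟩, ?_⟩⟩
    rw [Units.val_mk0, show g / f₀ - 1 = (g - f₀) / f₀ by field_simp, map_div₀, hvf₀, div_one, ← hϖn]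
    exact hg
  let toUn : R₀ → Un := fun g => ⟨Units.mk0 ((g : K) / f₀) (hR₀Un g g.2).choose, (hR₀Un g g.2).choose_spec⟩
  have htoUn : ∀ g : R₀, ((toUn g : Kˣ) : K) = (g : K) / f₀ := fun _ => rfl
  have hcoe : ∀ (g : R₀) (u : Un), ((((toUn g)⁻¹ * u : Un) : Kˣ) : K) = ((g : K) / f₀)⁻¹ * ((u : Kˣ) : K) := fun g u => by
    rw [Subgroup.coe_mul, Subgroup.coe_inv, Units.val_mul, Units.val_inv_eq_inv_val, htoUn]
  let ψ : R₀ → Un ⧸ Un1.subgroupOf Un := fun g => QuotientGroup.mk (toUn g)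
  have hψ : Function.Bijective ψ := by
    constructor
    · intro g g' h
      apply Subtype.ext
      change (QuotientGroup.mk (toUn g) : Un ⧸ Un1.subgroupOf Un) = QuotientGroup.mk (toUn g') at h
      rw [QuotientGroup.eq, Subgroup.mem_subgroupOf, hUn1, hcoe, htoUn] at h
      obtain ⟨-, h⟩ := h
      have hvg : Valued.v (g : K) = 1 := (hR1 g g.2.1).2
      have hg0 : (g : K) ≠ 0 := fun h0 => by rw [h0, map_zero] at hvg; exact zero_ne_one hvg
      have e : ((g : K) / f₀)⁻¹ * ((g' : K) / f₀) - 1 = ((g' : K) - g) / g := by field_simp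
      rw [e, map_div₀, hvg, div_one, Valuation.map_sub_swap, ← hϖn1] at h
      exact hR3 g g.2.1 g' g'.2.1 h
    · intro c
      induction c using QuotientGroup.induction_on with
      | H u =>
        obtain ⟨⟨hσu, hvu⟩, hu1⟩ := (hUn u).1 u.2
        -- the fixed unit `f := f₀·u` of the class, and its representative
        have hσf : σ (f₀ * ((u : Kˣ) : K)) = f₀ * ((u : Kˣ) : K) := by rw [map_mul, hσf₀, hσu]
        have hvf : Valued.v (f₀ * ((u : Kˣ) : K)) = 1 := by rw [map_mul, hvf₀, hvu, one_mul]
        obtain ⟨g, hgR, hfg⟩ := hR2 _ hσf hvf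
        have hnear : Valued.v (g - f₀) ≤ Valued.v ϖ ^ n := by
          have e : g - f₀ = f₀ * (((u : Kˣ) : K) - 1) + -(f₀ * ((u : Kˣ) : K) - g) := by ring
          rw [e]
          refine (Valuation.map_add _ _ _).trans (max_le ?_ ?_)
          · rw [map_mul, hvf₀, one_mul, hϖn]; exact hu1
          · rw [Valuation.map_neg]; exact hfg.trans hϖle
        refine ⟨⟨g, hgR, hnear⟩, ?_⟩
        change (QuotientGroup.mk (toUn ⟨g, hgR, hnear⟩) : Un ⧸ Un1.subgroupOf Un) = QuotientGroup.mk u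
        rw [QuotientGroup.eq, Subgroup.mem_subgroupOf, hUn1]
        have hmem : (((toUn ⟨g, hgR, hnear⟩)⁻¹ * u : Un) : Kˣ) ∈ Un := Subtype.mem _
        rw [hUn] at hmem
        refine ⟨hmem.1, ?_⟩
        have hvg : Valued.v g = 1 := (hR1 g hgR).2
        have hg0 : g ≠ 0 := fun h0 => by rw [h0, map_zero] at hvg; exact zero_ne_one hvg
        have e : (g / f₀)⁻¹ * ((u : Kˣ) : K) - 1 = (f₀ * ((u : Kˣ) : K) - g) / g := by field_simp
        rw [hcoe]
        change Valued.v ((g / f₀)⁻¹ * ((u : Kˣ) : K) - 1) ≤ exp (-((n + 1 : ℕ) : ℤ))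
        rw [e, map_div₀, hvg, div_one, ← hϖn1]
        exact hfg
  -- count
  have hfin₀ : R₀.Finite := hRfin.subset (Set.sep_subset _ _)
  haveI : Finite R₀ := hfin₀.to_subtype
  rw [← Nat.card_coe_set_eq, Nat.card_congr (Equiv.ofBijective ψ hψ), ← Subgroup.index_eq_card]
  exact hB

end Summit.HodgeConjecture.HodgeConjecture.Cruxes.H413.F0P3cDyRamDiagonalFixedClassRefinementCount

end
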